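import Mathlib
import Summits.MatrixMultiplication.Statement
import Summits.MatrixMultiplication.MatrixMultiplication.Theorems.GraphEquationsKernelSection

/-!
# GraphEquations — THE ISOLATION LOCUS and the max-rank locus (M18f-1, decomp-mm-lens-5 g31)

(supports `MultiplicityReduction`, stmt-MatrixMultiplication-27806, hand 1 = BOP′ at `K = 2`.)

Reduction of the last classical input **B3** `IsolationAtMaxRank` of the jet-truncation engine to a
PURE-ALGEBRA genericity statement **`IsoLocusOpen`** (no equation systems, no cost, no graph):

> for a finite family of forms `H_o ∈ ℂ[y][F]`, homogeneous in `F` of positive degrees, whose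
> specialisation at `y₀` has only the trivial common zero, there is a polynomial `g ∈ ℂ[y]` with
> `g(y₀) ≠ 0` such that the specialisation at every `y` with `g(y) ≠ 0` has only the trivial zero.

(`IsoLocusOpen` is the affine-cone form of "the image of a closed subset of `𝔸 × ℙ` is closed";
it follows from Hilbert's Nullstellensatz and Cramer's rule — see the companion file.)

* `InitIsolatedFam.generic`, `EqSystem.IdealInitIsolatedAt.generic` — under `IsoLocusOpen`, initial
  isolation at `y₀` propagates to a Zariski-dense set `{g ≠ 0} ∋ y₀` (same isolating family).
* `EqSystem.exists_maxRank_poly` — a non-zero `Δ ∈ ℂ[y]` with `{Δ ≠ 0} ⊆` max-rank locus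
  (a maximal non-vanishing minor of the polynomial row matrix).
* `isolationAtMaxRank_of_isoLocusOpen : IsoLocusOpen → IsolationAtMaxRank` (`gΔ ≠ 0` has a non-root),
  hence `boundedOrderPurification_two_of_isoLocusOpen`.

No `sorry`.  Sources: [CoxLittleOShea2015, Ch. 8 §5 (projective extension theorem)];
[LeykinVerscheldeZhao2006, §3].
-/

set_option linter.dupNamespace false

noncomputable section

open scoped BigOperators

namespace Summit.MatrixMultiplication.MatrixMultiplication.Theorems.GraphEquations

open MvPolynomial GraphEquations
open Literature.Computability.AlgebraicComplexity

variable {n : ℕ}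

/-- **GENERIC OPENNESS OF THE TRIVIAL-FIBRE LOCUS** (pure algebra).  For forms `H_o ∈ ℂ[y][F]`
homogeneous in `F` of positive degree `d_o`: if the specialised system at `y₀` has only the trivial
zero, then so does the specialised system at every `y` off a hypersurface `{g = 0} ∌ y₀`. -/
def IsoLocusOpen : Prop :=
  ∀ (n T : ℕ) (H : Fin T → FPoly n) (d : Fin T → ℕ),
    (∀ o, (H o).IsHomogeneous (d o)) → (∀ o, 1 ≤ d o) → ∀ y₀ : MatMulVars n → ℂ,
    (∀ F : Fin n × Fin n → ℂ, (∀ o, eval F (map (eval y₀) (H o)) = 0) → F = 0) →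
    ∃ g : MvPolynomial (MatMulVars n) ℂ, eval y₀ g ≠ 0 ∧
      ∀ y : MatMulVars n → ℂ, eval y g ≠ 0 →
        ∀ F : Fin n × Fin n → ℂ, (∀ o, eval F (map (eval y) (H o)) = 0) → F = 0

/-! ## Isolation propagates generically -/

/-- Under `IsoLocusOpen`, an initially isolating family at `y₀` is initially isolating (with the same
data) at every base off a hypersurface avoiding `y₀`. -/
theorem InitIsolatedFam.generic (hO : IsoLocusOpen) {T : ℕ} {u : Fin T → MvPolynomial (GraphVars n) ℂ}
    {K : ℕ} {y₀ : MatMulVars n → ℂ} (h : InitIsolatedFam u K y₀) :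
    ∃ g : MvPolynomial (MatMulVars n) ℂ, eval y₀ g ≠ 0 ∧
      ∀ y : MatMulVars n → ℂ, eval y g ≠ 0 → InitIsolatedFam u K y := by
  classical
  obtain ⟨ν, G, hν, hGu, hlow, hF⟩ := h
  -- positive-order initial forms; order-0 members carry no condition and are replaced by `0`
  let H : Fin T → FPoly n := fun o => if 1 ≤ ν o then homogeneousComponent (ν o) (G o) else 0
  let d : Fin T → ℕ := fun o => max (ν o) 1
  have hH : ∀ o, (H o).IsHomogeneous (d o) := by
    intro o
    by_cases h1 : 1 ≤ ν o
    · simp only [H, d, if_pos h1, max_eq_left h1]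
      exact homogeneousComponent_isHomogeneous _ _
    · simp only [H, if_neg h1]
      exact isHomogeneous_zero _ _ _
  have hd : ∀ o, 1 ≤ d o := fun o => le_max_right _ _
  -- the two fibre conditions agree at every base
  have hequiv : ∀ (y : MatMulVars n → ℂ) (F : Fin n × Fin n → ℂ),
      (∀ o, eval F (map (eval y) (H o)) = 0) ↔
        (∀ o, eval F (map (eval y) (homogeneousComponent (ν o) (G o))) =
          eval 0 (map (eval y) (homogeneousComponent (ν o) (G o)))) := by
    intro y F
    refine forall_congr' fun o => ?_
    by_cases h1 : 1 ≤ ν o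
    · simp only [H, if_pos h1]
      rw [eval_zero_of_isHomogeneous ((homogeneousComponent_isHomogeneous (ν o) (G o)).map (eval y))
        (by omega)]
    · have h0 : ν o = 0 := by omega
      simp only [H, if_neg h1, h0, homogeneousComponent_zero, map_zero, map_C, eval_C]
  obtain ⟨g, hg0, hg⟩ := hO n T H d hH hd y₀ fun F hFH => hF F ((hequiv y₀ F).mp hFH)
  exact ⟨g, hg0, fun y hy => ⟨ν, G, hν, hGu, hlow, fun F hFy => hg y hy F ((hequiv y F).mpr hFy)⟩⟩

namespace EqSystem

/-- Under `IsoLocusOpen`, ideal initial isolation at `y₀` holds at every base off a hypersurface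
avoiding `y₀`. -/
theorem IdealInitIsolatedAt.generic (hO : IsoLocusOpen) {E : EqSystem n} {K : ℕ}
    {y₀ : MatMulVars n → ℂ} (h : E.IdealInitIsolatedAt K y₀) :
    ∃ g : MvPolynomial (MatMulVars n) ℂ, eval y₀ g ≠ 0 ∧
      ∀ y : MatMulVars n → ℂ, eval y g ≠ 0 → E.IdealInitIsolatedAt K y := by
  obtain ⟨T, u, hu, hfam⟩ := h
  obtain ⟨g, hg0, hg⟩ := hfam.generic hO
  exact ⟨g, hg0, fun y hy => ⟨T, u, hu, hg y hy⟩⟩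

/-! ## The max-rank locus contains a principal open set -/

/-- The polynomial row matrix of the tests: its evaluation at `y` is `J_C(graphPoint y)`. -/
def rowMatrixPoly (E : EqSystem n) :
    Matrix (Fin E.tests.length) (Fin n × Fin n) (MvPolynomial (MatMulVars n) ℂ) :=
  Matrix.of fun o q => rowPoly (E.testPoly (E.tests.get o)) q

/-- Evaluating the polynomial row matrix at `y` gives the `C`-Jacobian at `graphPoint y`. -/
theorem rowMatrixPoly_map_eval (E : EqSystem n) (y : MatMulVars n → ℂ) :
    E.rowMatrixPoly.map (eval y) = E.jacobianC (graphPoint y) := by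
  ext o q
  simp only [rowMatrixPoly, Matrix.map_apply, Matrix.of_apply, jacobianC, eval_rowPoly]

/-- **A principal open subset of the max-rank locus.**  Some non-zero `Δ ∈ ℂ[y]` (a maximal minor of
the polynomial row matrix, non-vanishing at a base of maximal rank) has `{Δ ≠ 0} ⊆ {MaxRankAt}`. -/
theorem exists_maxRank_poly (E : EqSystem n) :
    ∃ Δ : MvPolynomial (MatMulVars n) ℂ, Δ ≠ 0 ∧ ∀ y : MatMulVars n → ℂ, eval y Δ ≠ 0 → E.MaxRankAt y := by
  classical
  -- a base of maximal rank exists (ranks are bounded by `n²`)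
  let S : Set ℕ := Set.range fun y : MatMulVars n → ℂ => (E.jacobianC (graphPoint y)).rank
  have hbdd : BddAbove S := by
    refine ⟨Fintype.card (Fin n × Fin n), ?_⟩
    rintro _ ⟨y, rfl⟩
    exact Matrix.rank_le_card_width _
  have hne : S.Nonempty := ⟨_, ⟨0, rfl⟩⟩
  obtain ⟨ys, hys⟩ := Nat.sSup_mem hne hbdd
  have hys' : (E.jacobianC (graphPoint ys)).rank = sSup S := hys
  have hle : ∀ y : MatMulVars n → ℂ,
      (E.jacobianC (graphPoint y)).rank ≤ (E.jacobianC (graphPoint ys)).rank :=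
    fun y => hys'.symm ▸ le_csSup hbdd ⟨y, rfl⟩
  -- a maximal non-vanishing minor at `ys`, as a polynomial
  obtain ⟨e, f, hef⟩ := exists_submatrix_det_ne_zero (E.jacobianC (graphPoint ys))
  refine ⟨(E.rowMatrixPoly.submatrix e f).det, ?_, ?_⟩
  · have hΔ : ∀ y : MatMulVars n → ℂ, eval y (E.rowMatrixPoly.submatrix e f).det =
        ((E.jacobianC (graphPoint y)).submatrix e f).det := by
      intro y
      rw [RingHom.map_det, RingHom.mapMatrix_apply, ← Matrix.submatrix_map, rowMatrixPoly_map_eval]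
    intro h
    exact hef (by rw [← hΔ, h, map_zero])
  · intro y hy y'
    have hΔ : eval y (E.rowMatrixPoly.submatrix e f).det =
        ((E.jacobianC (graphPoint y)).submatrix e f).det := by
      rw [RingHom.map_det, RingHom.mapMatrix_apply, ← Matrix.submatrix_map, rowMatrixPoly_map_eval]
    have hge : (E.jacobianC (graphPoint ys)).rank ≤ (E.jacobianC (graphPoint y)).rank := by
      by_contra hlt
      push Not at hlt
      apply hy
      rw [hΔ]
      exact det_submatrix_eq_zero_of_rank_lt _ (by simpa using hlt) e f
    exact (hle y').trans hge

end EqSystem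

/-- A non-zero polynomial over `ℂ` has a non-root. -/
theorem exists_eval_ne_zero {σ : Type*} {p : MvPolynomial σ ℂ} (hp : p ≠ 0) :
    ∃ y : σ → ℂ, eval y p ≠ 0 := by
  by_contra h
  push Not at h
  exact hp (MvPolynomial.funext fun y => by rw [h y, map_zero])

/-- **B3 from generic openness**: `IsoLocusOpen → IsolationAtMaxRank`.  The isolation locus contains
`{g ≠ 0} ∋ y₀`, the max-rank locus contains `{Δ ≠ 0} ≠ ∅`, and `gΔ ≠ 0` has a non-root. -/
theorem isolationAtMaxRank_of_isoLocusOpen (hO : IsoLocusOpen) : IsolationAtMaxRank := by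
  intro n E y₀ _hE hiso
  obtain ⟨g, hg0, hg⟩ := hiso.generic hO
  obtain ⟨Δ, hΔ, hΔmax⟩ := E.exists_maxRank_poly
  have hgne : g ≠ 0 := fun h => hg0 (by rw [h, map_zero])
  obtain ⟨y, hy⟩ := exists_eval_ne_zero (mul_ne_zero hgne hΔ)
  rw [map_mul] at hy
  exact ⟨y, hg y (left_ne_zero_of_mul hy), hΔmax y (right_ne_zero_of_mul hy)⟩

/-- Rung `K = 2` of bounded-order purification from the pure-algebra statement `IsoLocusOpen`. -/
theorem boundedOrderPurification_two_of_isoLocusOpen (hO : IsoLocusOpen) :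
    ∀ β : ℝ, 2 ≤ β → EqAdmissibleIdealIso β 2 → ∀ β' : ℝ, β < β' → EqAdmissiblePure β' :=
  boundedOrderPurification_two_of_isolationAtMaxRank (isolationAtMaxRank_of_isoLocusOpen hO)

/-- The same for reduced systems (`MultiplicityReduction` currency). -/
theorem eqAdmissibleRed_of_isoLocusOpen (hO : IsoLocusOpen) {β : ℝ}
    (h : EqAdmissibleIdealIso β 2) {β' : ℝ} (hββ' : β < β') : EqAdmissibleRed β' :=
  eqAdmissibleRed_of_isolationAtMaxRank (isolationAtMaxRank_of_isoLocusOpen hO) h hββ'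

end Summit.MatrixMultiplication.MatrixMultiplication.Theorems.GraphEquations

end
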